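import Summits.NavierStokesRegularity.FluidComputer.RowChainEnclosure
import Summits.NavierStokesRegularity.FluidComputer.RowCircuitFlow
import HarnessLib

/-!
# The EXACT circuit passes all 1066 certified enclosures of the k53d chain (layers T + A + A′ + R,
# exact class; `pub-fluidc-bp3/R1-DESIGN.md` §11.9)

HONEST FRAMING (cell `pub-fluidc`, blueprint seat bp3, gen 22): low prior, high value-of-information
experiment on Tao's machine paradigm; NOT a claim that NS blows up.

WHAT. Layer R discharged for the first trajectory class — the UNPERTURBED circuit `ẏ = F gK ΛK y`
started at the designed state `X0 = x̂₀(0)` (row `0`'s reference at local time `0`): the global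
solution of `RowCircuitFlow.circuit_solution` (energy conservation) with defect `δF = 0` on
`D = ℝ` satisfies every phase-independent hypothesis of `RowChain.enclosure` — the ODE, continuity
of the lock speed, the tube and window defect classes (because the certified radii `δ_k`, `DEL` are
nonnegative: the sign conditions every passing row carries), maximality (trivially, `D = ℝ`), and
the start data (`z(T 0) = 0` and `u₀ ≥ 0`). Hence `RowChain.circuit_enclosure`: WITHOUT HYPOTHESES,
there exist phase maps under which the exact circuit from `X0`, re-timed, starts every one of the
1066 rows in the row's box, stays within `Ē` of the reference polynomial and within `W̄` in frame
coordinates, at phase rate within `ρ` of `1`. (Perturbed classes — a nonzero defect from modes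
outside the circuit — are the remaining business of layer R: the same eight hypotheses, with the
defect envelopes of `passive_k53d.json`.)

[cite: Tao2016AveragedNS, §5.5 Thm 5.3 (5.5)]
-/

noncomputable section

namespace Summit.NavierStokesRegularity.FluidComputer

open Literature.Analysis.FluidPDE.FluidComputer

namespace RowCheck.RowData

open RowRun ChainField Set

variable {r : RowData}

/-- A member that starts ON the reference has frame coordinates `0` at the row start. [folklore] -/
theorem z_start_zero (Fr : r.Frames) (G : r.GateOK) (T0 : ℝ) (y δF : ℝ → Fin 9 → ℝ) (D : Set ℝ)
    (s sd : ℝ → ℝ) (h : y (s T0) = fun a => xh r.CQ 0 a) :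
    (toModel Fr G T0 ⟨y, δF, D, s, sd⟩).z T0 = 0 := by
  have he : (toModel Fr G T0 ⟨y, δF, D, s, sd⟩).e T0 = 0 := by
    funext a
    show y (s T0) a - xh r.CQ (T0 - T0) a = 0
    rw [h, sub_self T0, sub_self]
  simp only [RowModel.z, he, Matrix.mulVec_zero]

end RowCheck.RowData

namespace RowChain

open RowCheck RowCheck.RowData RowRun ChainField Set

/-- **The designed initial state**: row `0`'s reference polynomial at local time `0`. [folklore] -/
def X0 : Fin 9 → ℝ := fun a => xh (row 0).CQ 0 a

/-- Every row of the chain carries the sign conditions. [folklore] -/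
theorem signsOK_row (k : ℕ) : (row k).signsOK = true :=
  (flags ((runOK_iff _).mp (runOK_row k)).1).2.2.2.2

/-- `DEL ≥ 0` on every row. [folklore] -/
theorem DEL_nonneg_row (k : ℕ) (a : Fin 9) : 0 ≤ (row k).DEL a :=
  (nnOK_iff.mp (signsOK_row k)).2.2.2.1 a

/-- `δ ≥ 0` on every row. [folklore] -/
theorem δR_nonneg_row (k : ℕ) (a : Fin 9) : 0 ≤ (row k).δR a :=
  toR_nonneg (DEL_nonneg_row k a)

/-- `u₀ ≥ 0` on every row. [folklore] -/
theorem ubR_zero_nonneg_row (k : ℕ) (i : Fin 8) : 0 ≤ (row k).ubR 0 i := by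
  have h := (nnOK_iff.mp (signsOK_row k)).2.2.1 i
  simp only [ubR, us, blocks, Vec.get_mk']
  exact toR_nonneg h

/-- **Layers T + A + A′ + R (exact class): the exact circuit from the designed state passes all 1066
certified enclosures of the k53d chain, after a re-timing that exists.** No hypotheses beyond the
choice of the row start times `T (k+1) = T k + H_k`. [folklore] -/
theorem circuit_enclosure (T : ℕ → ℝ) (hT : ∀ k, T (k + 1) = T k + (row k).Hq) :
    ∃ y : ℝ → Fin 9 → ℝ, y 0 = X0 ∧ (∀ σ, HasDerivAt y (F gK ΛK (y σ)) σ) ∧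
    ∃ sA sdA sB sdB sD sdD : ℝ → ℝ, sA (T 0) = 0 ∧ ∀ k < 1066,
      (∀ i, |(toModel (canon (framesOK_row k)) (G k) (T k)
        (mOf ⟨y, 0, univ, sA, sdA⟩ ⟨y, 0, univ, sB, sdB⟩ ⟨y, 0, univ, sD, sdD⟩ k)).z (T k) i| ≤
          (row k).ubR 0 i) ∧
      (∀ t ∈ Icc (T k) (T (k + 1)), ∀ a, |(toModel (canon (framesOK_row k)) (G k) (T k)
        (mOf ⟨y, 0, univ, sA, sdA⟩ ⟨y, 0, univ, sB, sdB⟩ ⟨y, 0, univ, sD, sdD⟩ k)).e t a| ≤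
          (row k).EbarR a) ∧
      (∀ t ∈ Icc (T k) (T (k + 1)), ∀ i, |(toModel (canon (framesOK_row k)) (G k) (T k)
        (mOf ⟨y, 0, univ, sA, sdA⟩ ⟨y, 0, univ, sB, sdB⟩ ⟨y, 0, univ, sD, sdD⟩ k)).z t i| ≤
          (row k).WbarR i) ∧
      (∀ t ∈ Ico (T k) (T (k + 1)),
        |(mOf ⟨y, 0, univ, sA, sdA⟩ ⟨y, 0, univ, sB, sdB⟩ ⟨y, 0, univ, sD, sdD⟩ k).sd t - 1| ≤
          (row k).rhoR) := by
  obtain ⟨y, hy0, hsol⟩ := CircuitFlow.circuit_solution gK ΛK X0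
  have hyc : Continuous y := continuous_iff_continuousAt.2 fun σ => (hsol σ).continuousAt
  have hwin : ∀ (k k' : ℕ) (a : Fin 9), |(0 : ℝ → Fin 9 → ℝ) 0 a| ≤
      ((max ((row k).DEL a) ((row k').DEL a) : ℤ) : ℝ) / 2 ^ (row k').P :=
    fun k k' a => by
    rw [Pi.zero_apply, Pi.zero_apply, abs_zero]
    exact div_nonneg (by exact_mod_cast (DEL_nonneg_row k a).trans (le_max_left _ _))
      (by positivity)
  obtain ⟨sA, sdA, sB, sdB, sD, sdD, hs0, h⟩ := enclosure T hT (y := y) (δF := 0) (D := univ)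
    isOpen_univ
    (fun σ _ a => by simpa using (hasDerivAt_pi.1 (hsol σ)) a)
    (fun k _ => by
      have hc : Continuous fun σ => F gK ΛK (y σ) (row k).p :=
        (continuous_apply (row k).p).comp ((continuous_F gK ΛK).comp hyc)
      simpa using hc)
    (fun k _ σ _ t _ _ a => by simpa using δR_nonneg_row k a)
    (fun K _ _ => subset_univ _)
    (fun σ _ _ => ⟨subset_univ _, fun ξ _ a => hwin 656 657 a⟩)
    (fun σ _ _ => ⟨subset_univ _, fun ξ _ a => hwin 986 987 a⟩)
    (σ₀ := 0) (mem_univ _) (by rw [hy0]; rfl)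
    (fun i => by
      rw [z_start_zero _ _ _ y 0 univ (fun _ => 0) (fun _ => 0) (by show y 0 = X0; exact hy0)]
      simpa using ubR_zero_nonneg_row 0 i)
  exact ⟨y, hy0, hsol, sA, sdA, sB, sdB, sD, sdD, hs0, h⟩

end RowChain

end Summit.NavierStokesRegularity.FluidComputer
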